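import Summits.RiemannHypothesis.RiemannHypothesis.Theorems.Splittings.ScrewBridgeFozConsequences
import Summits.RiemannHypothesis.RiemannHypothesis.Theorems.Splittings.ScrewBridgeWeakTail
import Summits.RiemannHypothesis.RiemannHypothesis.Theorems.Splittings.ScrewNullCombinationFoz
import HarnessLib

/-!
# Splittings — SCREW BRIDGE g5, node reduction: atomic mean-zero witnesses ⟹ negative eigenvalues of `S_n`

Zero-def carve (seat rh-split-typer-2 g3, R10.8 hand-on of `cards/SPLIT-screw-bridge.md` §10) of §7 of the scratch of record
`HOME/rh-split-screw-bridge/ScrewBridgeG5.lean` (sha16 c26d31e4e9941ae1, seat rh-split-screw-bridge g5; farm rc 0 / 0 sorry, std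
axioms); declaration blocks byte-identical, original namespace kept; companions `ScrewFormWeil.lean` (§4–§5, §8) and
`ScrewIndexTransferLim.lean` (§6, §9).  CONTENT (kernel, unconditional, ZERO-FREE): `kernelForm_eq_of_sum_eq_zero`,
`kernelForm_translate`, `kernelForm_smul`, `kernelForm_sub_le`, `pushforward_form`, `continuous_kernelTable`, and
`negIndex_ge_of_atomicWitness` — if `q` MEAN-ZERO real coefficient vectors on finitely many real positions have a negative definite
Gram matrix for the kernel form `Σ β_p β_{p'} G_g(x_p, x_{p'})`, then every large screw matrix `S_n` has `≥ q` negative eigenvalues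
(translation invariance on mean-zero vectors from `G_g(t,u) = Ψ(t)+Ψ(u)−Ψ(t−u)`, continuity of `Ψ`, `2e^{−t}`-density of the nodes
`ScrewNullComb.exists_node`, openness of negative definiteness on the compact unit sphere, Courant–Fischer
`Literature…card_le_card_eigenvalues_lt`).  [folklore]/[new] as tagged per decl.

HONEST LABEL (cell rh-split): SPLITTING SEARCH over kernel-typed RH-EQUIVALENCES; a splitting A ∧ B ⟹ RH is CONDITIONAL
bookkeeping unless A and B are both proved; nothing here bears on the truth of RH.
-/

set_option linter.dupNamespace false

noncomputable section

namespace Summit.RiemannHypothesis.RiemannHypothesis.Theorems.Splittings.ScrewBridgeG5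

open Filter Topology Finset Complex
open Literature.NumberTheory.LFunctions
open Summit.RiemannHypothesis.RiemannHypothesis.Theses.RuelleBand
open Summit.RiemannHypothesis.RiemannHypothesis.Theorems.IntegerScrew

/-! ## §7 Node reduction (kernel, elementary): atomic mean-zero witnesses ⟹ negative eigenvalues of `S_n`

The second half of the g5 argument for `U_quad`, in kernel and free of any zero input: if `q` MEAN-ZERO real
coefficient vectors `α_k` on finitely many real positions `x_p` have a negative definite Gram matrix for the kernel
form `Σ_{p,p'} β_p β_{p'} G_g(x_p, x_{p'})`, then every large screw matrix `S_n` has at least `q` negative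
eigenvalues.  Ingredients: the kernel form of a mean-zero vector is translation invariant
(`G_g(t,u) = Ψ(t)+Ψ(u)−Ψ(t−u)`), `Ψ` is continuous, the nodes `log m` are `2e^{-t}`-dense at height `t`
(`ScrewNullComb.exists_node`), negative definiteness is open (compact unit sphere), and Courant–Fischer
(`Literature.card_le_card_eigenvalues_lt`). -/

/-- The kernel form of a mean-zero coefficient vector only sees differences of positions. [folklore] -/
theorem kernelForm_eq_of_sum_eq_zero {r : ℕ} (β : Fin r → ℝ) (hβ : ∑ p, β p = 0) (y : Fin r → ℝ) :
    ∑ p, ∑ p', β p * β p' * zetaScrewKernel (y p) (y p') =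
      -∑ p, ∑ p', β p * β p' * zetaScrew (y p - y p') := by
  simp only [zetaScrewKernel_def, mul_add, mul_sub, Finset.sum_add_distrib, Finset.sum_sub_distrib]
  have h1 : ∑ p, ∑ p', β p * β p' * zetaScrew (y p) = 0 := by
    have : ∀ p, ∑ p', β p * β p' * zetaScrew (y p) = β p * zetaScrew (y p) * ∑ p', β p' := by
      intro p; rw [Finset.mul_sum]; exact Finset.sum_congr rfl fun p' _ => by ring
    simp [this, hβ]
  have h2 : ∑ p, ∑ p', β p * β p' * zetaScrew (y p') = 0 := by
    rw [Finset.sum_comm]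
    have : ∀ p', ∑ p, β p * β p' * zetaScrew (y p') = β p' * zetaScrew (y p') * ∑ p, β p := by
      intro p'; rw [Finset.mul_sum]; exact Finset.sum_congr rfl fun p _ => by ring
    simp [this, hβ]
  rw [h1, h2]; ring

/-- Translation invariance of the kernel form on mean-zero vectors. [folklore] -/
theorem kernelForm_translate {r : ℕ} (β : Fin r → ℝ) (hβ : ∑ p, β p = 0) (y : Fin r → ℝ) (U : ℝ) :
    ∑ p, ∑ p', β p * β p' * zetaScrewKernel (y p + U) (y p' + U) =
      ∑ p, ∑ p', β p * β p' * zetaScrewKernel (y p) (y p') := by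
  rw [kernelForm_eq_of_sum_eq_zero β hβ, kernelForm_eq_of_sum_eq_zero β hβ]
  simp only [add_sub_add_right_eq_sub]

/-- Homogeneity of the kernel form in the combination coefficients. [folklore] -/
theorem kernelForm_smul {q r : ℕ} (a : ℝ) (c : Fin q → ℝ) (α : Fin q → Fin r → ℝ) (K : Fin r → Fin r → ℝ) :
    ∑ p, ∑ p', (∑ k, a * c k * α k p) * (∑ k, a * c k * α k p') * K p p' =
      a ^ 2 * ∑ p, ∑ p', (∑ k, c k * α k p) * (∑ k, c k * α k p') * K p p' := by
  have h : ∀ p, ∑ k, a * c k * α k p = a * ∑ k, c k * α k p := fun p => by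
    rw [Finset.mul_sum]; exact Finset.sum_congr rfl fun k _ => by ring
  rw [Finset.mul_sum]
  refine Finset.sum_congr rfl fun p _ => ?_
  rw [Finset.mul_sum]
  refine Finset.sum_congr rfl fun p' _ => ?_
  rw [h p, h p']; ring

/-- Perturbation bound for the kernel form: coefficients of sup-norm `≤ 1`, kernel entries moved by `≤ ε`.
[folklore] -/
theorem kernelForm_sub_le {q r : ℕ} (c : Fin q → ℝ) (hc : ∀ k, |c k| ≤ 1) (α : Fin q → Fin r → ℝ)
    (K K' : Fin r → Fin r → ℝ) {ε : ℝ} (hK : ∀ p p', |K p p' - K' p p'| ≤ ε) :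
    |∑ p, ∑ p', (∑ k, c k * α k p) * (∑ k, c k * α k p') * K p p' -
        ∑ p, ∑ p', (∑ k, c k * α k p) * (∑ k, c k * α k p') * K' p p'| ≤
      (∑ p, ∑ p', (∑ k, |α k p|) * (∑ k, |α k p'|)) * ε := by
  have hβ : ∀ p, |∑ k, c k * α k p| ≤ ∑ k, |α k p| := by
    intro p
    refine (Finset.abs_sum_le_sum_abs _ _).trans (Finset.sum_le_sum fun k _ => ?_)
    rw [abs_mul]
    exact mul_le_of_le_one_left (abs_nonneg _) (hc k)
  rw [← Finset.sum_sub_distrib, Finset.sum_mul]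
  refine (Finset.abs_sum_le_sum_abs _ _).trans (Finset.sum_le_sum fun p _ => ?_)
  rw [← Finset.sum_sub_distrib, Finset.sum_mul]
  refine (Finset.abs_sum_le_sum_abs _ _).trans (Finset.sum_le_sum fun p' _ => ?_)
  rw [← mul_sub, abs_mul, abs_mul]
  have h1 := hβ p
  have h2 := hβ p'
  have h3 := hK p p'
  have ha : 0 ≤ ∑ k, |α k p| := Finset.sum_nonneg fun k _ => abs_nonneg _
  have ha' : 0 ≤ ∑ k, |α k p'| := Finset.sum_nonneg fun k _ => abs_nonneg _
  exact mul_le_mul (mul_le_mul h1 h2 (abs_nonneg _) ha) h3 (abs_nonneg _) (mul_nonneg ha ha')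

open scoped Matrix in
/-- Pushing an `r`-point combination forward to the nodes: the matrix form of the node vector. [folklore] -/
theorem pushforward_form {n r : ℕ} (S : Matrix (Fin n) (Fin n) ℝ) (jp : Fin r → Fin n) (β : Fin r → ℝ) :
    (fun j => ∑ p, if jp p = j then β p else 0) ⬝ᵥ S *ᵥ (fun j => ∑ p, if jp p = j then β p else 0) =
      ∑ p, ∑ p', β p * β p' * S (jp p) (jp p') := by
  have h1 : ∀ g : Fin n → ℝ, ∑ j, (∑ p, if jp p = j then β p else 0) * g j = ∑ p, β p * g (jp p) := by
    intro g
    simp only [Finset.sum_mul, ite_mul, zero_mul]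
    rw [Finset.sum_comm]
    simp only [Finset.sum_ite_eq, Finset.mem_univ, if_true]
  have h2 : ∀ j : Fin n, (S *ᵥ fun j => ∑ p, if jp p = j then β p else 0) j = ∑ p', β p' * S j (jp p') := by
    intro j
    simp only [Matrix.mulVec, dotProduct, Finset.mul_sum, mul_ite, mul_zero]
    rw [Finset.sum_comm]
    simp only [Finset.sum_ite_eq, Finset.mem_univ, if_true]
    exact Finset.sum_congr rfl fun p' _ => by ring
  simp only [dotProduct, h2]
  rw [h1]
  refine Finset.sum_congr rfl fun p _ => ?_
  rw [Finset.mul_sum]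
  exact Finset.sum_congr rfl fun p' _ => by ring

/-- Continuity of the finite kernel table in the positions. [folklore] -/
theorem continuous_kernelTable (r : ℕ) :
    Continuous fun y : Fin r → ℝ => fun p p' : Fin r => zetaScrewKernel (y p) (y p') := by
  refine continuous_pi fun p => continuous_pi fun p' => ?_
  simp only [zetaScrewKernel_def]
  exact ((continuous_zetaScrew.comp (continuous_apply p)).add
    (continuous_zetaScrew.comp (continuous_apply p'))).sub
    (continuous_zetaScrew.comp ((continuous_apply p).sub (continuous_apply p')))

open scoped Matrix in
/-- **Node reduction (kernel, unconditional, zero-free).** If `q` mean-zero real coefficient vectors on `r`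
real positions have a negative definite Gram matrix for the kernel form of `G_g`, then every large screw matrix
has at least `q` negative eigenvalues. [new] -/
theorem negIndex_ge_of_atomicWitness (q r : ℕ) (x : Fin r → ℝ) (α : Fin q → Fin r → ℝ)
    (hmean : ∀ k, ∑ p, α k p = 0)
    (hneg : ∀ c : Fin q → ℝ, c ≠ 0 →
      ∑ p, ∑ p', (∑ k, c k * α k p) * (∑ k, c k * α k p') * zetaScrewKernel (x p) (x p') < 0) :
    ∃ N : ℕ, ∀ n : ℕ, N ≤ n →
      q ≤ (Finset.univ.filter fun i => (screwMatrix_isHermitian n).eigenvalues i < 0).card := by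
  rcases Nat.eq_zero_or_pos q with hq | hq
  · exact ⟨0, fun n _ => by rw [hq]; exact Nat.zero_le _⟩
  haveI : Nonempty (Fin q) := ⟨⟨0, hq⟩⟩
  -- mean zero of every combination
  have hβmean : ∀ c : Fin q → ℝ, ∑ p, ∑ k, c k * α k p = 0 := by
    intro c
    rw [Finset.sum_comm]
    refine Finset.sum_eq_zero fun k _ => ?_
    rw [← Finset.mul_sum, hmean k, mul_zero]
  -- Step 1: a margin `δ` on the unit sphere (sup norm)
  have hcont : Continuous fun c : Fin q → ℝ =>
      ∑ p, ∑ p', (∑ k, c k * α k p) * (∑ k, c k * α k p') * zetaScrewKernel (x p) (x p') := by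
    fun_prop
  have hS : IsCompact (Metric.sphere (0 : Fin q → ℝ) 1) := isCompact_sphere _ _
  have hSne : (Metric.sphere (0 : Fin q → ℝ) 1).Nonempty := NormedSpace.sphere_nonempty.2 zero_le_one
  obtain ⟨c₀, hc₀S, hmax⟩ := hS.exists_isMaxOn hSne hcont.continuousOn
  have hc₀ne : c₀ ≠ 0 := by
    intro h; rw [h] at hc₀S; simp at hc₀S
  set δ : ℝ := -∑ p, ∑ p', (∑ k, c₀ k * α k p) * (∑ k, c₀ k * α k p') * zetaScrewKernel (x p) (x p')
    with hδ
  have hδpos : 0 < δ := by have := hneg c₀ hc₀ne; rw [hδ]; linarith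
  have hsph : ∀ c ∈ Metric.sphere (0 : Fin q → ℝ) 1,
      ∑ p, ∑ p', (∑ k, c k * α k p) * (∑ k, c k * α k p') * zetaScrewKernel (x p) (x p') ≤ -δ := by
    intro c hc; have := hmax hc; rw [hδ, neg_neg]; exact this
  -- Step 2: continuity of the kernel table at `x`
  set M : ℝ := ∑ p, ∑ p', (∑ k, |α k p|) * (∑ k, |α k p'|) with hM
  have hM0 : 0 ≤ M := Finset.sum_nonneg fun p _ => Finset.sum_nonneg fun p' _ =>
    mul_nonneg (Finset.sum_nonneg fun k _ => abs_nonneg _) (Finset.sum_nonneg fun k _ => abs_nonneg _)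
  obtain ⟨η, hηpos, hη⟩ := Metric.continuous_iff.1 (continuous_kernelTable r) x (δ / (M + 1)) (by positivity)
  -- Step 3: the shift `U` and the nodes
  set L : ℝ := ∑ p, |x p| with hL
  have hxL : ∀ p, -L ≤ x p := fun p =>
    (neg_le_neg (Finset.single_le_sum (fun i _ => abs_nonneg (x i)) (Finset.mem_univ p))).trans (neg_abs_le _)
  set U : ℝ := L + Real.log 2 + 1 + 2 / η with hU
  have hlog2 : 0 < Real.log 2 := Real.log_pos (by norm_num)
  have htU : ∀ p, Real.log (((0 : ℕ) : ℝ) + 2) + 1 ≤ x p + U := by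
    intro p; have := hxL p; simp only [Nat.cast_zero, zero_add]; rw [hU]
    have : 0 < 2 / η := by positivity
    linarith
  choose m hm using fun p => ScrewNullComb.exists_node 0 (htU p)
  have hm2 : ∀ p, 2 ≤ m p := fun p => by have := (hm p).1; omega
  -- closeness of the nodes to the shifted positions
  have hclose : ∀ p, |Real.log (m p) - U - x p| < η := by
    intro p
    have h1 := (hm p).2.2.2.1
    have h2 : 2 * Real.exp (-(x p + U)) < η := by
      have hle : x p + U ≥ 2 / η := by have := hxL p; rw [hU]; linarith
      have h3 : Real.exp (-(x p + U)) ≤ Real.exp (-(2 / η)) := Real.exp_le_exp.2 (by linarith)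
      have h4 : Real.exp (-(2 / η)) < η / 2 := by
        have h5 : 2 / η + 1 ≤ Real.exp (2 / η) := Real.add_one_le_exp _
        have h6 : 0 < 2 / η + 1 := by positivity
        have h8 : Real.exp (-(2 / η)) ≤ 1 / (2 / η + 1) := by
          rw [Real.exp_neg, ← one_div]; exact one_div_le_one_div_of_le h6 h5
        have h9 : 1 / (2 / η + 1) = η / (2 + η) := by
          rw [div_add_one hηpos.ne', one_div_div]
        have h10 : η / (2 + η) < η / 2 := div_lt_div_of_pos_left hηpos (by norm_num) (by linarith)
        linarith [h9 ▸ h8]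
      linarith
    rw [show Real.log (m p) - U - x p = -(x p + U - Real.log (m p)) by ring, abs_neg]
    linarith
  -- Step 4: the form at the nodes is negative for every non-zero combination
  have hnodeNeg : ∀ c : Fin q → ℝ, c ≠ 0 →
      ∑ p, ∑ p', (∑ k, c k * α k p) * (∑ k, c k * α k p') *
        zetaScrewKernel (Real.log (m p)) (Real.log (m p')) < 0 := by
    intro c hc
    -- translate back by `U`
    set d : Fin r → ℝ := fun p => Real.log (m p) - U - x p with hd
    have htr : ∑ p, ∑ p', (∑ k, c k * α k p) * (∑ k, c k * α k p') *
        zetaScrewKernel (Real.log (m p)) (Real.log (m p')) =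
        ∑ p, ∑ p', (∑ k, c k * α k p) * (∑ k, c k * α k p') *
          zetaScrewKernel ((x + d) p) ((x + d) p') := by
      rw [← kernelForm_translate _ (hβmean c) (x + d) U]
      refine Finset.sum_congr rfl fun p _ => Finset.sum_congr rfl fun p' _ => ?_
      simp only [hd, Pi.add_apply]; ring_nf
    rw [htr]
    -- normalise `c`
    set s : ℝ := ‖c‖ with hs
    have hs0 : 0 < s := norm_pos_iff.2 hc
    set c' : Fin q → ℝ := s⁻¹ • c with hc'
    have hc'S : c' ∈ Metric.sphere (0 : Fin q → ℝ) 1 := by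
      rw [mem_sphere_zero_iff_norm, hc', norm_smul, norm_inv, norm_norm, inv_mul_cancel₀ hs0.ne']
    have hcc' : c = s • c' := by rw [hc', smul_smul, mul_inv_cancel₀ hs0.ne', one_smul]
    have hc'1 : ∀ k, |c' k| ≤ 1 := fun k => by
      have := norm_le_pi_norm c' k
      rw [Real.norm_eq_abs, mem_sphere_zero_iff_norm.1 hc'S] at this
      exact this
    -- the kernel table moved by `< δ/(M+1)`
    have hdist : dist (x + d) x < η := by
      rw [dist_pi_lt_iff hηpos]
      intro p
      rw [Real.dist_eq, show (x + d) p - x p = d p by simp]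
      exact hclose p
    have hKε : ∀ p p', |zetaScrewKernel ((x + d) p) ((x + d) p') - zetaScrewKernel (x p) (x p')| ≤
        δ / (M + 1) := by
      intro p p'
      have h := hη (x + d) hdist
      have h1 : dist (zetaScrewKernel ((x + d) p) ((x + d) p')) (zetaScrewKernel (x p) (x p')) ≤
          dist (fun p p' : Fin r => zetaScrewKernel ((x + d) p) ((x + d) p'))
            (fun p p' : Fin r => zetaScrewKernel (x p) (x p')) :=
        (dist_le_pi_dist (fun p' : Fin r => zetaScrewKernel ((x + d) p) ((x + d) p'))
            (fun p' : Fin r => zetaScrewKernel (x p) (x p')) p').trans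
          (dist_le_pi_dist (fun p p' : Fin r => zetaScrewKernel ((x + d) p) ((x + d) p'))
            (fun p p' : Fin r => zetaScrewKernel (x p) (x p')) p)
      rw [Real.dist_eq] at h1
      linarith
    have hpert := kernelForm_sub_le c' hc'1 α
      (fun p p' => zetaScrewKernel ((x + d) p) ((x + d) p')) (fun p p' => zetaScrewKernel (x p) (x p')) hKε
    have hbase := hsph c' hc'S
    have hMlt : M * (δ / (M + 1)) < δ := by
      have h1 : M / (M + 1) < 1 := (div_lt_one (by positivity)).2 (by linarith)
      have h2 : M * (δ / (M + 1)) = δ * (M / (M + 1)) := by ring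
      rw [h2]
      calc δ * (M / (M + 1)) < δ * 1 := mul_lt_mul_of_pos_left h1 hδpos
        _ = δ := mul_one δ
    have hc'neg : ∑ p, ∑ p', (∑ k, c' k * α k p) * (∑ k, c' k * α k p') *
        zetaScrewKernel ((x + d) p) ((x + d) p') < 0 := by
      have := abs_le.1 hpert
      linarith [this.2]
    -- scale back
    have hscale : ∑ p, ∑ p', (∑ k, c k * α k p) * (∑ k, c k * α k p') *
        zetaScrewKernel ((x + d) p) ((x + d) p') =
        s ^ 2 * ∑ p, ∑ p', (∑ k, c' k * α k p) * (∑ k, c' k * α k p') *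
          zetaScrewKernel ((x + d) p) ((x + d) p') := by
      rw [← kernelForm_smul s c' α]
      simp only [hcc', Pi.smul_apply, smul_eq_mul]
    rw [hscale]
    exact mul_neg_of_pos_of_neg (by positivity) hc'neg
  -- Step 5: embed into `ℝ^n` for `n ≥ N` and apply Courant–Fischer
  refine ⟨∑ p, m p, fun n hn => ?_⟩
  have hjlt : ∀ p, m p - 2 < n := fun p =>
    lt_of_lt_of_le (by have := hm2 p; omega)
      ((Finset.single_le_sum (fun i _ => Nat.zero_le (m i)) (Finset.mem_univ p)).trans hn)
  let jp : Fin r → Fin n := fun p => ⟨m p - 2, hjlt p⟩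
  have hnode : ∀ p, Real.log ((((jp p : Fin n) : ℕ) + 2 : ℕ) : ℝ) = Real.log (m p) := by
    intro p
    have : ((jp p : Fin n) : ℕ) + 2 = m p := by simp only [jp]; have := hm2 p; omega
    rw [this]
  let V : Matrix (Fin n) (Fin q) ℝ := Matrix.of fun j k => ∑ p, if jp p = j then α k p else 0
  have hV : ∀ c : Fin q → ℝ, V *ᵥ c = fun j => ∑ p, if jp p = j then (∑ k, c k * α k p) else 0 := by
    intro c; funext j
    simp only [V, Matrix.mulVec, dotProduct, Matrix.of_apply, Finset.sum_mul, ite_mul, zero_mul]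
    rw [Finset.sum_comm]
    refine Finset.sum_congr rfl fun p _ => ?_
    split_ifs with h
    · exact Finset.sum_congr rfl fun k _ => mul_comm _ _
    · simp
  have key := Literature.Analysis.Matrix.EigenvalueCount.card_le_card_eigenvalues_lt (screwMatrix_isHermitian n) V (θ := 0) (by
    intro c hc
    rw [zero_mul, hV c, pushforward_form]
    have h := hnodeNeg c hc
    simp only [screwMatrix, Matrix.of_apply, hnode]
    exact h)
  simpa using key

end Summit.RiemannHypothesis.RiemannHypothesis.Theorems.Splittings.ScrewBridgeG5

end
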